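import Summits.MatrixMultiplication.MatrixMultiplication.Theorems.AbelianSTPPCensusTAStatDefs
import Summits.MatrixMultiplication.MatrixMultiplication.Theorems.AbelianSTPPCensusTBStatData
import Summits.MatrixMultiplication.MatrixMultiplication.Theorems.AbelianSTPPCensusTBGainTable2375

/-!
# T_B static certificate, orders `2881 … 5000`: theory's t*-indexed linear checker with a free budget parameter at `τ = 2375/1000` (definitions)

Cell mm-stpp (rung F-M1), tier T_B = «beat `2.375` (Coppersmith–Winograd)»; successor kernel item of the closed crux item stmt-MatrixMultiplication-19191, seat mm-stpp-vp-p2 (gen 4);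
companion of the T_D / T_C instances `AbelianSTPPCensusTDStatDefs.lean` / `…TCStatDefs.lean` (same session).  This file is theory g12's `AbelianSTPPCensusTAStatCDefs.lean`
(design: `AbelianSTPPCensusTAStatDefs.lean`, theory g11) VERBATIM with the range constants and the gain exchanged: universe `Mtop = 5000`, orders
`lo = 2881 … 5000`, table `TBStatData.E` (46 levels × 73 buckets, per-bucket Grynkiewicz parameters `TBStatData.TP`), gains `ShapeCert.gainOfTB`
(`⌈10⁶·V^(19/24)⌉`, certified in `AbelianSTPPCensusTBGainTable2375.lean`); the data-free parts of the checker (`TAStat.tm`, `e0`, `domP`, `leP`, `leW`, `vpI`,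
`p1I`, `p2I`, `p3I`, `piece`, `pcs`, `vpCand`, `vpThresh`, `cover`) are reused by name — they take the gain as an argument and do not depend on `τ`.
The one-member static relaxation certifies T_B at every order `2881 … 5000` (sizing: first uncovered order `5216` at universe `5700`) (exact twin: theory's HOME/mm-stpp-theory/tastat2/tastat2.py
with the gain patched to `τ = 2.375`, seat folder calc/tbstat/, run `b_5000_60`: all 1479410 (shape, bucket) checks pass).
Soundness: `AbelianSTPPCensusTBStat{Rows,Sound}.lean`; kernel evaluations `…TBStatDom*/Ck*`; leaf `AbelianSTPPCensusLeafTB5000Closed.lean` (`noAbelianSTPPHostUpTo_2375_5000`).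
WHAT THIS IS NOT: no statement about STPP families or `ω` — arithmetic on shape lists only; nothing about orders `> 5000` or `< 2881`.
-/

set_option linter.dupNamespace false
set_option autoImplicit false

namespace Summit.MatrixMultiplication.MatrixMultiplication.Theorems.TBStat

open TECert (tableOK vol us)
open ShapeCert (gainOfTB D)
open TBStatData (E VL TB TP)
open TAStat (tm Entry e0 domP leP leW vpI p1I p2I p3I piece pcs vpCand vpThresh cover)

/-! ## Parameters -/

/-- Largest order of the certificate (= the order of the single-member table defining the candidate shapes). -/
def Mtop : ℕ := 5000
/-- Least order of the certificate (orders `≤ 2880`: `noAbelianSTPPHostUpTo_240_2880` and `noAbelianSTPPHostUpTo_anti`). -/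
def lo : ℕ := 2881
/-- Number of sub-intervals of orders on which the vM bound is re-checked by endpoint evaluation when one interval does not suffice. -/
def J : ℕ := 12

/-! ## Candidate shapes (sorted), levels and buckets -/

/-- The sorted candidate shapes `(a, b, c)`, `a ≤ b ≤ c`, of volume exactly `V`, passing `TECert.tableOK` at order `Mtop`
(`a ≤ 17`, `b ≤ 70` suffice since `18³ = 5832 > Mtop` and `71² = 5041 > Mtop`). -/
def triplesS (V : ℕ) : List (ℕ × ℕ × ℕ) :=
  (List.range 17).flatMap fun a' =>
    if V % (a' + 1) = 0 then
      (List.range 70).filterMap fun b' =>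
        if a' ≤ b' ∧ V / (a' + 1) % (b' + 1) = 0 ∧ b' + 1 ≤ V / (a' + 1) / (b' + 1) ∧
            tableOK Mtop (a' + 1) (b' + 1) (V / (a' + 1) / (b' + 1)) = true then
          some (a' + 1, b' + 1, V / (a' + 1) / (b' + 1))
        else none
    else []

/-- level of a volume: the first index `i` with `V ≤ VL[i]` (`VL.length` if none). -/
def levOf (V : ℕ) : ℕ := VL.findIdx fun vl => decide (V ≤ vl)

/-- bucket of a parameter `t ≥ 1`: the last index `j` with `TB[j] ≤ t` (computed as (first index with `t < TB[j]`) − 1). -/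
def bucketOf (t : ℕ) : ℕ := (TB.findIdx fun b => decide (t < b)) - 1

/-- lower end `TB[j]` of bucket `j` (default `0`) -/
def tb (j : ℕ) : ℕ := TB.getD j 0

/-- budget parameter `TP[j]` of bucket `j` (default `0`); `TP[j] ≤ TB[j]`, and `TP[j] = TB[j]` or `19 ≤ TP[j]` (checked in `monoOK`) -/
def tp (j : ℕ) : ℕ := TP.getD j 0

/-! ## The table entries -/

/-- entry `(i, j)` of the table -/
def ent (i j : ℕ) : Entry := (E.getD i []).getD j e0

/-- U11-G domination of a shape (gain `g`, volume `V`, pair-product sum `p`) along a table row from bucket `j` on, each entry read at its own bucket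
budget parameter `t = TP[j]`: `V < t·p` and `g·wW ≤ gW·(t·p − V)`. -/
def domWrow (g V p : ℕ) : List Entry → ℕ → Bool
  | [], _ => true
  | e :: es, j => Nat.blt V (tp j * p) && Nat.ble (g * e.2.2.2) (e.2.2.1 * (tp j * p - V)) && domWrow g V p es (j + 1)

/-- domination of one sorted candidate shape `x` of volume `V` (gain `g`): vM at its own (level, bucket), U11-G at its own level and every bucket
from its own on. -/
def domX (V g : ℕ) (x : ℕ × ℕ × ℕ) : Bool :=
  domP g (us x) ((E.getD (levOf V) []).getD (bucketOf (tm x)) e0) &&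
    domWrow g V (us x) ((E.getD (levOf V) []).drop (bucketOf (tm x))) (bucketOf (tm x))

/-- every sorted candidate shape of the volumes `V, …, V + n − 1` is dominated (`domX`) -/
def domV : ℕ → ℕ → Bool
  | 0, _ => true
  | n + 1, V => (triplesS V).all (domX V (gainOfTB V)) && domV n (V + 1)

/-- Structural facts about the data, all checked by evaluation: every row has `nb` entries; all denominators are positive; the vM fraction is
monotone in the level and in the bucket, the U11-G fraction is monotone in the level; `TB[0] = 1`, `TB` is increasing with `TB[j+1] ≤ 2·TB[j]`
and (`TB[j] ≤ 1` or `TB[j+1] ≤ TB[j]²`); `TP[j] = TB[j]` or `19 ≤ TP[j]`, and `TP[j] ≤ TB[j]`. -/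
def monoOK (nl nb : ℕ) : Bool :=
  Nat.beq (tb 0) 1 &&
  (List.range nl).all (fun i => Nat.beq (E.getD i []).length nb &&
    (List.range nb).all (fun j =>
      Nat.ble 1 (ent i j).2.1 && Nat.ble 1 (ent i j).2.2.2 &&
      (Nat.ble (nl - 1) i || (leP (ent i j) (ent (i + 1) j) && leW (ent i j) (ent (i + 1) j))) &&
      (Nat.ble (nb - 1) j || leP (ent i j) (ent i (j + 1))))) &&
  (List.range nb).all (fun j => Nat.blt (tb j) (tb (j + 1)) && Nat.ble (tb (j + 1)) (2 * tb j) &&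
    (Nat.ble (tb j) 1 || Nat.ble (tb (j + 1)) (tb j * tb j)) &&
    (Nat.beq (tp j) (tb j) || Nat.ble 19 (tp j)) && Nat.ble (tp j) (tb j))

/-! ## The checks (data-free parts reused from `TAStat`) -/

/-- Walk the buckets `j, j+1, …` of a table row (the row dropped to index `j`) while `TB[j]³ ≤ V²`, checking `cover` at the budget parameter `t = TP[j]`. -/
def walk (g p V d L H : ℕ) : List Entry → ℕ → Bool
  | [], _ => true
  | e :: es, j => Nat.blt (V * V) (tb j * tb j * tb j) || (cover g p V d (tp j) L H e && walk g p V d L H es (j + 1))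

/-- The check of one sorted candidate shape `x` of volume `V` (gain `g`) as the maximal-volume member, for all orders `max(lo, V+1) … Mtop` and all
buckets from that of `x.1·x.2.1` on. -/
def checkShape (V g : ℕ) (x : ℕ × ℕ × ℕ) : Bool :=
  Nat.blt Mtop (max lo (V + 1)) ||
    walk g (us x) V (2 * us x - (x.1 + x.2.1 + x.2.2)) (max lo (V + 1)) Mtop
      ((E.getD (levOf V) []).drop (bucketOf (x.1 * x.2.1))) (bucketOf (x.1 * x.2.1))

/-- every sorted candidate shape of the volumes `V, …, V + n − 1` passes `checkShape` -/
def checkV : ℕ → ℕ → Bool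
  | 0, _ => true
  | n + 1, V => (triplesS V).all (checkShape V (gainOfTB V)) && checkV n (V + 1)

/-! ## Specification vocabulary of the soundness proof (checker-internal predicates, no claims) -/

/-- Sorted candidate shapes: `1 ≤ a ≤ b ≤ c` and the single-member table at order `Mtop`. [bookkeeping] -/
def SCand (x : ℕ × ℕ × ℕ) : Prop :=
  1 ≤ x.1 ∧ x.1 ≤ x.2.1 ∧ x.2.1 ≤ x.2.2 ∧ tableOK Mtop x.1 x.2.1 x.2.2 = true

end Summit.MatrixMultiplication.MatrixMultiplication.Theorems.TBStat
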